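import Summits.KontsevichZagierPeriods.KontsevichZagierPeriods.Theses.HurwitzMicroSectors
import Summits.KontsevichZagierPeriods.KontsevichZagierPeriods.Theorems.HurwitzMicroSectorsNormalFormPrinciplePiBoxTransfer
import Summits.KontsevichZagierPeriods.KontsevichZagierPeriods.Theorems.HurwitzMicroSectorsNormalFormPrincipleVariants2239

/-! TTRL-lite variant V2279 of stmt-KontsevichZagierPeriods-3869

Variant V2279 = `stub_boxRigidity` (the leaf `BoxRigidity` of `NormalFormPrinciple`: two BOX-RATIONAL
representations — domain the open unit box, integrand `p/q` over `ℚ`, `q ≠ 0` on the box — with equal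
values are KZ-equivalent) under the move `bound_nat:m≤4; bound_nat:m'≤6`. Verdict of the attempt seat:
**open** — this file is the exact-strength certificate, not a proof of the variant. A joint bound is one
dimension (`boxRigidityLe_iff_boxVanishing`, file `…Variants2239`, instance `j = 4`, `k = 6`): the
variant is EXACTLY BoxVanishing in dimension `max 4 6 = 6` — every box-rational representation on
`(0,1)⁶` of value `0` is a KZ relation (`stub_boxRigidity_var2279_iff_boxVanishing_six`); equivalently
BoxRigidity under the joint bound `m, m' ≤ 6` (`stub_boxRigidity_var2279_iff_le_six`, verbatim the
right-hand side of the sibling certificate `stub_boxRigidity_var2278_iff_le_six`, so V2279 coincides with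
V2278 / V2295 / V2302 / V2304). It implies BoxVanishing in every dimension `≤ 6`
(`boxVanishing_le_six_of_stub_boxRigidity_var2279`), whose level `2` (every vanishing absolutely
convergent `∫∫_{(0,1)²} p/q`, `p, q ∈ ℚ[x,y]`, is generated by the four moves: Catalan's `G` versus
`π²`, `Li₂` at rationals, `log·log`, `L(2,χ)` …) is open; the tree proves dimension `≤ 1` only
(`boxRigidity_of_le_one`, Baker). Conversely `KontsevichZagierPeriods ⇒ parent ⇒ V2279`
(`stub_boxRigidity_var2279_of_statement`), so a refutation of the variant would refute the Summit, and
no invariant of `KZ.relations` finer than `eval` is known (soundness `relations_le_ker_eval_holds`).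
Residual goal (verbatim, `lean check`): `M : IntegralRep 6, hMd : M.domain = {x | ∀ i, x i ∈ Ioo 0 1},
hMr : M.IsRational, hv : M.value = 0 ⊢ of M ∈ relations`.
Source: M. Kontsevich, D. Zagier, *Periods* (2001), §1.2 Conjecture 1. Pure proof file, no definitions. -/

-- `Summit.<Summit>.<Problem>` is the tree's mandated summit-side namespace (CONVENTIONS §2); for this
-- single-conjunct summit the two coincide, so the duplicate is deliberate.
set_option linter.dupNamespace false

noncomputable section

namespace Summit.KontsevichZagierPeriods.KontsevichZagierPeriods.Theorems

open MeasureTheory Set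
open Literature.NumberTheory.Transcendental Literature.NumberTheory.Transcendental.KZ
open Summit.KontsevichZagierPeriods.KontsevichZagierPeriods.Theses.HurwitzMicroSectors
open Summit.KontsevichZagierPeriods.HurwitzMicroSectors.NormalFormPrinciple.PiBox

/-! ## The variant V2279: exactly `BoxVanishing 6` -/

/-- **V2279 ⟺ BoxVanishing in dimension `6`** (every box-rational representation on `(0,1)⁶` of
value `0` is a KZ relation): instance `j = 4`, `k = 6` of `boxRigidityLe_iff_boxVanishing`
(`max 4 6 = 6`). [cite: KontsevichZagier2001, §1.2 Conjecture 1] -/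
theorem stub_boxRigidity_var2279_iff_boxVanishing_six :
    (∀ (m m' : ℕ) (N : IntegralRep m) (N' : IntegralRep m'), m' ≤ 6 → m ≤ 4 → N.domain = {x | ∀ i, x i ∈ Set.Ioo (0:ℝ) 1} → N.IsRational → N'.domain = {x | ∀ i, x i ∈ Set.Ioo (0:ℝ) 1} → N'.IsRational → N.value = N'.value → Equivalent N N') ↔
    (∀ (M : IntegralRep 6), M.domain = {x | ∀ i, x i ∈ Set.Ioo (0:ℝ) 1} → M.IsRational →
      M.value = 0 → of M ∈ relations) :=
  boxRigidityLe_iff_boxVanishing 4 6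

/-- **V2279 ⟺ BoxRigidity under the joint bound `m, m' ≤ 6`** (the honest strength of the variant:
the bound `m ≤ 4` loses nothing once `m' ≤ 6` is allowed, `Equivalent` being symmetric; this
right-hand side is verbatim that of `stub_boxRigidity_var2278_iff_le_six`).
[cite: KontsevichZagier2001, §1.2 Conjecture 1] -/
theorem stub_boxRigidity_var2279_iff_le_six :
    (∀ (m m' : ℕ) (N : IntegralRep m) (N' : IntegralRep m'), m' ≤ 6 → m ≤ 4 → N.domain = {x | ∀ i, x i ∈ Set.Ioo (0:ℝ) 1} → N.IsRational → N'.domain = {x | ∀ i, x i ∈ Set.Ioo (0:ℝ) 1} → N'.IsRational → N.value = N'.value → Equivalent N N') ↔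
    (∀ (m m' : ℕ) (N : IntegralRep m) (N' : IntegralRep m'), m ≤ 6 → m' ≤ 6 →
      N.domain = {x | ∀ i, x i ∈ Set.Ioo (0:ℝ) 1} → N.IsRational →
      N'.domain = {x | ∀ i, x i ∈ Set.Ioo (0:ℝ) 1} → N'.IsRational →
      N.value = N'.value → Equivalent N N') := by
  rw [stub_boxRigidity_var2279_iff_boxVanishing_six]
  exact ⟨fun hvan m m' N N' hm hm' => boxRigidityLe_of_boxVanishing (j := 6) (k := 6) le_rfl le_rfl
      hvan m m' N N' hm' hm,
    fun h => boxVanishing_of_boxRigidityLe (j := 6) (k := 6) le_rfl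
      fun m m' N N' hm' hm => h m m' N N' hm hm'⟩

/-- **V2279 ⇒ BoxVanishing in every dimension `≤ 6`** (monotonicity along padding,
`boxVanishing_mono`); the first open level is `2`. [cite: KontsevichZagier2001, §1.2 Conjecture 1] -/
theorem boxVanishing_le_six_of_stub_boxRigidity_var2279
    (h : ∀ (m m' : ℕ) (N : IntegralRep m) (N' : IntegralRep m'), m' ≤ 6 → m ≤ 4 → N.domain = {x | ∀ i, x i ∈ Set.Ioo (0:ℝ) 1} → N.IsRational → N'.domain = {x | ∀ i, x i ∈ Set.Ioo (0:ℝ) 1} → N'.IsRational → N.value = N'.value → Equivalent N N')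
    {j : ℕ} (hj : j ≤ 6) (N : IntegralRep j) (hNd : N.domain = {x | ∀ i, x i ∈ Set.Ioo (0:ℝ) 1})
    (hNr : N.IsRational) (hv : N.value = 0) : of N ∈ relations :=
  boxVanishing_mono hj (stub_boxRigidity_var2279_iff_boxVanishing_six.1 h) N hNd hNr hv

/-- **BoxVanishing `6` ⇒ V2279** (the form in which a future proof of the dimension-`6` kernel
statement would be consumed). [cite: KontsevichZagier2001, §1.2 Conjecture 1] -/
theorem stub_boxRigidity_var2279_of_boxVanishing_six
    (hvan : ∀ (M : IntegralRep 6), M.domain = {x | ∀ i, x i ∈ Set.Ioo (0:ℝ) 1} → M.IsRational →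
      M.value = 0 → of M ∈ relations) :
    ∀ (m m' : ℕ) (N : IntegralRep m) (N' : IntegralRep m'), m' ≤ 6 → m ≤ 4 → N.domain = {x | ∀ i, x i ∈ Set.Ioo (0:ℝ) 1} → N.IsRational → N'.domain = {x | ∀ i, x i ∈ Set.Ioo (0:ℝ) 1} → N'.IsRational → N.value = N'.value → Equivalent N N' :=
  stub_boxRigidity_var2279_iff_boxVanishing_six.2 hvan

/-- **The parent leaf ⇒ V2279** (specialisation: both bounds are dropped).
[cite: KontsevichZagier2001, §1.2 Conjecture 1] -/
theorem stub_boxRigidity_var2279_of_parent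
    (h : ∀ (m m' : ℕ) (N : IntegralRep m) (N' : IntegralRep m'), N.domain = {x | ∀ i, x i ∈ Set.Ioo (0:ℝ) 1} → N.IsRational → N'.domain = {x | ∀ i, x i ∈ Set.Ioo (0:ℝ) 1} → N'.IsRational → N.value = N'.value → Equivalent N N') :
    ∀ (m m' : ℕ) (N : IntegralRep m) (N' : IntegralRep m'), m' ≤ 6 → m ≤ 4 → N.domain = {x | ∀ i, x i ∈ Set.Ioo (0:ℝ) 1} → N.IsRational → N'.domain = {x | ∀ i, x i ∈ Set.Ioo (0:ℝ) 1} → N'.IsRational → N.value = N'.value → Equivalent N N' :=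
  fun m m' N N' _ _ => h m m' N N'

/-- **`KontsevichZagierPeriods ⇒ V2279`**: the variant is a special case of Conjecture 1 for the
tree's calculus (`leaves_of_statement`) — so a refutation of the variant would refute the Summit.
[cite: KontsevichZagier2001, §1.2 Conjecture 1] -/
theorem stub_boxRigidity_var2279_of_statement (h : _root_.KontsevichZagierPeriods) :
    ∀ (m m' : ℕ) (N : IntegralRep m) (N' : IntegralRep m'), m' ≤ 6 → m ≤ 4 → N.domain = {x | ∀ i, x i ∈ Set.Ioo (0:ℝ) 1} → N.IsRational → N'.domain = {x | ∀ i, x i ∈ Set.Ioo (0:ℝ) 1} → N'.IsRational → N.value = N'.value → Equivalent N N' :=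
  stub_boxRigidity_var2279_of_parent (leaves_of_statement h).1

end Summit.KontsevichZagierPeriods.KontsevichZagierPeriods.Theorems

end
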